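import Summits.QuantumFields.YangMills.Theorems.UnitScaleTiltAxialGaugeTorusTransfer
import Summits.QuantumFields.YangMills.Theorems.UnitScaleTiltCurvGradAxialHolder
import Literature.MathematicalPhysics.QuantumFieldTheory.Balaban1983to89.T3PrintedRegularMinimiser
import HarnessLib

/-!
# `UnitScaleTiltAxialGaugeMemberModulus` — THE (★) MEMBER ROW, CLOSED: for an `SU(N)` torus configuration with BOTH clauses of print's regular space
# (8) — `PlaqSmall a U` ([B7] (2)₁ = [B6] (1.7)) AND the covariant-divergence clause `‖(D^{1*}_U ∂U)(b)‖ ≤ b₀` ([B6] (1.9), the tree's `DivSmall`)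
# — the TORUS AXIAL-GAUGE REPRESENTATIVE `U^{v₀}`, `v₀ = axialT U y`, is `½`-HÖLDER AT SCALE `R` on every no-wrap ball:
# `dist1 ((U^{v₀})(y + x + s, μ)·(U^{v₀})(y + x, μ)⁻¹) ≤ R·(d·a + d²·C·(a + R·b₀ + R²·a²))·√(S∕R)` for `|x|_∞, |x + s|_∞ ≤ R`, `|s|_∞ ≤ S`, `1 ≤ S ≤ R − 1`
# (route `UnitScaleTilt`, crux K1′ `MinimiserStabilityRegPr` stmt-QuantumFields-19200, (L3′b)-GRAD row (★) «η-scale ½-Hölder modulus of the axial-gauge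
# representative»; ★★OWNER RULING №35-B; ★p1 g25 CHAIR WORD №4 «R1 + the torus transfer → px19», PIN «both `RegPr` clauses visible, explicit no-wrap antecedent»)

Cell `ym3-torus` (YM ladder rung R3 = continuum SU(2) Yang–Mills on T³ — a RUNG, NOT the Clay problem: not d = 4, not infinite volume, not a mass gap);
width seat `ym3-torus-px19` (gen 12); helper `--supports stmt-QuantumFields-19200`.  THEOREMS ONLY (0 `def`, 0 `sorry`, default heartbeats).

ASSEMBLY.  ✓`AxialGaugeTorusTransfer.dist1_axialT_translate_le_of_plaqModulus` (px19, file 3a: torus axial gauge = pulled-back complete axial gauge on the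
no-wrap ball; comb walk ✓`AxialGaugeBondModulus.dist1_axial_bond_translate_le`; `dist1 ↔ ‖·‖_op` dictionary) has ONE analytic input `hmodA`, the pair modulus
of the gauged plaquettes of the `M_N(ℂ)ˣ` pull-back in the axial gauge at `0`; w5 g14's ✓`CurvGradAxial.norm_plaqF_axial_sub_le` (R3′ FILE B v1.1, pair
form: K-UNIFORM, NO logarithm — lit ✓`B4Eq19LatticeInteriorHolder` through ✓`CurvGradFlat.tensor_holder_le`) supplies it from the WHOLE-LATTICE rows
`‖F − 1‖ ≤ a ≤ 1`, `‖D^{1*}F‖ ≤ b₀` of the periodic pull-back, which are the two clauses read through lit ✓`B10Eq27TorusAxialLog` ∕ ✓`B10Eq68TorusRegularity`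
(`norm_plaqF_pull_sub_one_le`, `norm_covDiv_pull_le` — verbatim the dictionary of ✓`CritCurvGradLog.regPr_curvGrad_lt`).  §3 reads the bound in the
(G1-2) currency: with `a = ε₀η²`, `b₀ = ε₀η³`, `R ≤ ℓ = η⁻¹` the right-hand side is `Θ·√(S∕R)`, `Θ = R(d·a + d²C(a + Rb₀ + R²a²)) ≤ ε₀η·(d + d²C(2 + ε₀))` —
the `hΘ` row of ✓`Prop7TwoBackgroundGradientComparison.two_background_gradient_comparison` (px12 g15) up to the chart `Site P j ↔ TSite`.
§4: the same for the members of a `T³` family under `PlaqSmall (regThreshold F n K ε) U ∧ DivSmall F n K ε U` — print's (8) = the tree's `RegPr` — BY NAME.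
§4′ (v1.1, APPEND-ONLY — §1–§3 byte-identical): the `hδ` COMPANION in the same gauge and letters — `dist1 ((U^{v₀})(y + x, μ)) ≤ |x|₁·a ≤ d·R·a` on the
no-wrap ball from the FIRST clause alone (lit ✓`B7Prop1Explicit.axial_bond_bound` through the torus transfer); the operator-norm readings of both rows
(`dist1 (X·Y⁻¹) = ‖X − Y‖` ✓`AxialGaugeTorusTransfer.dist1_mul_inv_eq_norm_sub`, `dist1 X = ‖X − 1‖` ✓`N09Chi217AEContinuous.dist1_eq_norm_coe_sub_one`) are cited, not restated.

HONEST SCOPE.  An η-scale regularity statement about ONE gauge representative of a regular configuration; nothing of GRAD's remaining rows (G1-1..3),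
`hT`, `hGF`, `hThm2S`, EX, `MinimiserStabilityRegPr` (19200) or the rung `YM3TorusSU2` is proved; no summit statement is proved; the Yang–Mills mass gap
is NOT proved.  References: [Balaban1985Averaging] (8)–(9) pp. 18–19, (19) p. 21, pp. 24–25; [Balaban1985RegularSpaces] (1.1)–(1.2) p. 76, (1.7)–(1.9)
p. 77; [Balaban1985Variational] (2), (8) p. 278; [Balaban1985UV3] (27) p. 263.
-/

set_option autoImplicit false

noncomputable section

open scoped Matrix.Norms.L2Operator
open Literature.MathematicalPhysics.QuantumFieldTheory.Balaban1983to89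
open Literature.MathematicalPhysics.QuantumFieldTheory.Balaban1983to89.B7Prop1Explicit (Letter e hol plaqWord gaugeAct axialFn U1 hol_mem
  norm_inv_sub_one_le)
open Literature.MathematicalPhysics.QuantumFieldTheory.Balaban1983to89.B10Eq27TorusAxialLog (transl pull pull_apply hol_pull axialT unitsField toUField
  unitsField_mem_unitaryUnits U1_of_unitaryUnits norm_holT_unitsField_plaqWord_sub_one dist1_plaqHol_toUField)
open Literature.MathematicalPhysics.QuantumFieldTheory.Balaban1983to89.B10Eq68TorusRegularity (covDivT covDiv_pull)
open Literature.MathematicalPhysics.QuantumFieldTheory.Balaban1983to89.B8Ineq132 (plaqF covDiv)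
open Literature.MathematicalPhysics.QuantumFieldTheory.Balaban1983to89.T3ContinuumYM3Torus (T3Family)
open Literature.MathematicalPhysics.QuantumFieldTheory.Balaban1983to89.T3RegularMinimiser (regThreshold)
open Literature.MathematicalPhysics.QuantumFieldTheory.Balaban1983to89.T3PrintedRegularMinimiser (DivSmall)
open Summit.QuantumFields.YangMills.Theorems.CurvGradAxial (norm_plaqF_axial_sub_le hol_plaqWord_swap)
open Summit.QuantumFields.YangMills.Theorems.AxialGaugeTorusTransfer (dist1_axialT_translate_le_of_plaqModulus)

namespace Summit.QuantumFields.YangMills.Theorems.AxialGaugeMemberModulus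

/-! ## §1 The two clauses of (8) read on the `M_N(ℂ)ˣ` pull-back (the dictionary of ✓`regPr_curvGrad_lt`, factored) -/

section Dictionary

variable {N : ℕ} [NeZero N] {P : Params} {j : ℕ}

/-- The `M_N(ℂ)ˣ` pull-back of an `SU(N)` torus configuration is `U1`-valued. [cite: Balaban1985Averaging, (19) p.21] -/
theorem pull_mem_U1 (U : GaugeField P j (Matrix.specialUnitaryGroup (Fin N) ℂ)) (y : Site P j) :
    ∀ (z : B7Prop1Explicit.Site P.d) (k : Fin P.d), pull (unitsField (toUField U)) y z k ∈ U1 (Matrix (Fin N) (Fin N) ℂ) := by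
  letI : CStarAlgebra (Matrix (Fin N) (Fin N) ℂ) := B10Eq29TubeLine.cstarAlgebraMatrix N
  exact fun z k => U1_of_unitaryUnits (fun b => unitsField_mem_unitaryUnits (toUField U) b) ⟨transl y z, k⟩

/-- **THE FIRST CLAUSE ON THE PULL-BACK**: `PlaqSmall a U` gives `‖F_{κμ}(z) − 1‖ ≤ a` for ALL index pairs `κ ≠ μ` of the `M_N(ℂ)ˣ` pull-back (the reversed
orientation is the inverse holonomy, not farther from `1` for unitaries). [cite: Balaban1985Variational, (2) p.278] -/
theorem norm_plaqF_pull_sub_one_le (U : GaugeField P j (Matrix.specialUnitaryGroup (Fin N) ℂ)) {a : ℝ} (hU : PlaqSmall a U) (y : Site P j)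
    (z : B7Prop1Explicit.Site P.d) (κ μ : Fin P.d) (hne : κ ≠ μ) : ‖plaqF (pull (unitsField (toUField U)) y) κ μ z - 1‖ ≤ a := by
  have hpos : ∀ (z' : B7Prop1Explicit.Site P.d) (κ₁ μ₁ : Fin P.d) (h : κ₁ < μ₁), ‖plaqF (pull (unitsField (toUField U)) y) κ₁ μ₁ z' - 1‖ ≤ a := by
    intro z' κ₁ μ₁ h
    have e1 : plaqF (pull (unitsField (toUField U)) y) κ₁ μ₁ z' =
        ((hol (pull (unitsField (toUField U)) y) z' (plaqWord κ₁ μ₁) : (Matrix (Fin N) (Fin N) ℂ)ˣ) : Matrix (Fin N) (Fin N) ℂ) := rfl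
    rw [e1, hol_pull, norm_holT_unitsField_plaqWord_sub_one (toUField U) _ h, dist1_plaqHol_toUField]
    exact (hU _).le
  rcases lt_or_gt_of_ne hne with hlt | hgt
  · exact hpos z κ μ hlt
  · have e1 : plaqF (pull (unitsField (toUField U)) y) κ μ z =
        (((hol (pull (unitsField (toUField U)) y) z (plaqWord μ κ))⁻¹ : (Matrix (Fin N) (Fin N) ℂ)ˣ) : Matrix (Fin N) (Fin N) ℂ) := by
      show ((hol (pull (unitsField (toUField U)) y) z (plaqWord κ μ) : (Matrix (Fin N) (Fin N) ℂ)ˣ) : Matrix (Fin N) (Fin N) ℂ) = _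
      rw [hol_plaqWord_swap (pull (unitsField (toUField U)) y) μ κ z]
    rw [e1]
    exact (norm_inv_sub_one_le (hol_mem (pull_mem_U1 U y) z _)).trans (hpos z μ κ hgt)

omit [NeZero N] in
/-- **THE SECOND CLAUSE ON THE PULL-BACK**: the covariant-divergence clause `‖(D^{1*}_U ∂U)_μ(x)‖ ≤ b₀` (the tree's `DivSmall`, [B6] (1.9)) gives
`‖covDiv 1 (U♭)♯_y μ z‖ ≤ b₀` (lit ✓`covDiv_pull`). [cite: Balaban1985RegularSpaces, (1.9) p.77] -/
theorem norm_covDiv_pull_le (U : GaugeField P j (Matrix.specialUnitaryGroup (Fin N) ℂ)) {b₀ : ℝ}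
    (hD : ∀ bd : PBond P j, ‖covDivT 1 (unitsField (toUField U)) bd.dir bd.src‖ ≤ b₀) (y : Site P j) (z : B7Prop1Explicit.Site P.d) (μ : Fin P.d) :
    ‖covDiv 1 (pull (unitsField (toUField U)) y) μ z‖ ≤ b₀ := by
  rw [covDiv_pull]; exact hD ⟨transl y z, μ⟩

end Dictionary

/-! ## §2 ★★★ The (★) member row, closed -/

section MemberRow

variable {N : ℕ} [NeZero N]

/-- `S ≤ R·√(S∕R)` for `0 ≤ S ≤ R` (the Lipschitz part `d·S·a` of the comb walk in the `½`-Hölder currency). [folklore] -/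
theorem le_mul_sqrt_div {S R : ℝ} (hS : 0 ≤ S) (hSR : S ≤ R) : S ≤ R * Real.sqrt (S / R) := by
  rw [Real.sqrt_div hS, mul_div_assoc', mul_comm, ← mul_div_assoc', Real.div_sqrt]
  calc S = Real.sqrt S * Real.sqrt S := (Real.mul_self_sqrt hS).symm
    _ ≤ Real.sqrt S * Real.sqrt R := mul_le_mul_of_nonneg_left (Real.sqrt_le_sqrt hSR) (Real.sqrt_nonneg _)

/-- ★★★ **THE (★) MEMBER ROW — BOTH CLAUSES OF (8) ⟹ THE AXIAL-GAUGE REPRESENTATIVE IS `½`-HÖLDER AT SCALE `R`.**  For `d ≥ 1` there is `C ≥ 0` (w5's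
✓`norm_plaqF_axial_sub_le` constant) such that: for every torus `P` of dimension `d`, level `j`, every `U : GaugeField P j SU(N)` with
`PlaqSmall a U` (`0 ≤ a ≤ 1`) AND `‖(D^{1*}_U ∂U)_μ(x)‖ ≤ b₀` at every bond, every centre `y`, direction `μ`, radius `R ≥ 4` with NO WRAP-AROUND
`2(R + 1) ≤ sitesPerDir j`, every `S` with `1 ≤ S ≤ R − 1`, and all `x`, `x + s` in the ball `{|z_κ| ≤ R}` with `|s_κ| ≤ S`:
  `dist1 ((U^{v₀})(y + x + s, μ)·(U^{v₀})(y + x, μ)⁻¹) ≤ R·(d·a + d²·C·(a + R·b₀ + R²·a²))·√(S∕R)`,  `v₀ = axialT U y`.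
[cite: Balaban1985Averaging, pp.24-25; Balaban1985RegularSpaces, (1.7)-(1.9) p.77; Balaban1985Variational, (8) p.278] -/
theorem dist1_axialT_translate_le {d : ℕ} (hd : 1 ≤ d) : ∃ C : ℝ, 0 ≤ C ∧
    ∀ (P : Params), P.d = d → ∀ (j : ℕ) (U : GaugeField P j (Matrix.specialUnitaryGroup (Fin N) ℂ)) (a b₀ : ℝ), 0 ≤ a → a ≤ 1 →
    PlaqSmall a U → (∀ bd : PBond P j, ‖covDivT 1 (unitsField (toUField U)) bd.dir bd.src‖ ≤ b₀) →
    ∀ (y : Site P j) (μ : Fin P.d) (R S : ℕ), 4 ≤ R → 2 * (R + 1) ≤ P.sitesPerDir j → 1 ≤ S → S + 1 ≤ R →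
    ∀ (x s : B7Prop1Explicit.Site P.d), (∀ κ, |x κ| ≤ (R : ℤ)) → (∀ κ, |(x + s) κ| ≤ (R : ℤ)) → (∀ κ, |s κ| ≤ (S : ℤ)) →
      dist1 (GaugeField.gaugeAct (axialT U y) U ⟨transl y (x + s), μ⟩ * (GaugeField.gaugeAct (axialT U y) U ⟨transl y x, μ⟩)⁻¹) ≤
        R * (P.d * a + (P.d : ℝ) ^ 2 * (C * (a + R * b₀ + (R : ℝ) ^ 2 * a ^ 2))) * Real.sqrt ((S : ℝ) / R) := by
  obtain ⟨C, hC, hB⟩ := norm_plaqF_axial_sub_le (d := d) (𝔸 := Matrix (Fin N) (Fin N) ℂ) hd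
  refine ⟨C, hC, fun P hPd => ?_⟩
  subst hPd
  intro j U a b₀ ha ha1 hU hD y μ R S hR4 hRn hS1 hSR x s hx hxs hS
  have hb0 : 0 ≤ b₀ := (norm_nonneg _).trans (hD ⟨y, μ⟩)
  have hsq0 : 0 ≤ Real.sqrt ((S : ℝ) / R) := Real.sqrt_nonneg _
  set p : ℝ := C * (a + R * b₀ + (R : ℝ) ^ 2 * a ^ 2) * Real.sqrt ((S : ℝ) / R) with hp
  have hp0 : 0 ≤ p := by positivity
  -- the analytic input: FILE B on the pull-back, pairs `(z, z + t)`
  have hmodA : ∀ z t : B7Prop1Explicit.Site P.d, (∀ κ, |z κ| ≤ (R : ℤ)) → (∀ κ, |t κ| ≤ (S : ℤ)) → ∀ κ : Fin P.d, κ < μ →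
      ‖plaqF (gaugeAct (axialFn (pull (unitsField (toUField U)) y) 0) (pull (unitsField (toUField U)) y)) κ μ (z + t) -
        plaqF (gaugeAct (axialFn (pull (unitsField (toUField U)) y) 0) (pull (unitsField (toUField U)) y)) κ μ z‖ ≤ p := by
    intro z t hz ht κ _
    exact hB R hR4 _ (pull_mem_U1 U y) a b₀ ha ha1 (fun z' κ' μ' hne => norm_plaqF_pull_sub_one_le U hU y z' κ' μ' hne)
      (fun z' μ' => norm_covDiv_pull_le U hD y z' μ') κ μ z (z + t) S hS1 hSR hz (fun k => by simpa using ht k)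
  have h := dist1_axialT_translate_le_of_plaqModulus U ha hU y μ hRn hp0 hmodA x s hx hxs hS
  -- `d·S·a ≤ d·a·R·√(S/R)` and regroup
  have hSR' : (S : ℝ) ≤ R := by exact_mod_cast (show S ≤ R by omega)
  have hkey : (S : ℝ) ≤ R * Real.sqrt ((S : ℝ) / R) := le_mul_sqrt_div (Nat.cast_nonneg S) hSR'
  have hd0 : (0 : ℝ) ≤ P.d := Nat.cast_nonneg _
  have h1 : (P.d : ℝ) * S * a ≤ (P.d : ℝ) * (R * Real.sqrt ((S : ℝ) / R)) * a :=
    mul_le_mul_of_nonneg_right (mul_le_mul_of_nonneg_left hkey hd0) ha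
  calc _ ≤ (P.d : ℝ) * S * a + (P.d : ℝ) ^ 2 * R * p := h
    _ ≤ (P.d : ℝ) * (R * Real.sqrt ((S : ℝ) / R)) * a + (P.d : ℝ) ^ 2 * R * p := by linarith
    _ = R * (P.d * a + (P.d : ℝ) ^ 2 * (C * (a + R * b₀ + (R : ℝ) ^ 2 * a ^ 2))) * Real.sqrt ((S : ℝ) / R) := by rw [hp]; ring

end MemberRow

/-! ## §3 The same for the members of a `T³` family, print's (8) by name: `PlaqSmall (regThreshold F n K ε) U ∧ DivSmall F n K ε U` -/

section T3

/-- ★★★ **(★) FOR EVERY `(8)`-REGULAR CONFIGURATION OF A `T³` MEMBER** (`RegPr F n K ε U` unfolded into its two clauses, both displayed; `a = εL^{−2(K−n)} = εη²`,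
`b₀ = εL^{−3(K−n)} = εη³`): for `0 ≤ ε ≤ 1` there is the scale-`R` `½`-Hölder bound of `dist1_axialT_translate_le` for the torus axial gauge of `U` on every
no-wrap ball — with `R ≤ η⁻¹` the right-hand side is `≤ εη·(3 + 9C(2 + ε))·√(S∕R)`, the (G1-2) letter `Θ = O(εη)`.
[cite: Balaban1985Variational, (2) p.278, (8) p.278; Balaban1985RegularSpaces, (1.7)-(1.9) p.77] -/
theorem dist1_axialT_translate_le_of_clauses : ∃ C : ℝ, 0 ≤ C ∧
    ∀ (F : T3Family) (n K : ℕ) (ε : ℝ), 0 ≤ ε → ε ≤ 1 →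
    ∀ (U : GaugeField (F.P K) 0 (Matrix.specialUnitaryGroup (Fin 2) ℂ)), PlaqSmall (regThreshold F n K ε) U → DivSmall F n K ε U →
    ∀ (y : Site (F.P K) 0) (μ : Fin (F.P K).d) (R S : ℕ), 4 ≤ R → 2 * (R + 1) ≤ (F.P K).sitesPerDir 0 → 1 ≤ S → S + 1 ≤ R →
    ∀ (x s : B7Prop1Explicit.Site (F.P K).d), (∀ κ, |x κ| ≤ (R : ℤ)) → (∀ κ, |(x + s) κ| ≤ (R : ℤ)) → (∀ κ, |s κ| ≤ (S : ℤ)) →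
      dist1 (GaugeField.gaugeAct (axialT U y) U ⟨transl y (x + s), μ⟩ * (GaugeField.gaugeAct (axialT U y) U ⟨transl y x, μ⟩)⁻¹) ≤
        R * (3 * (ε * ((F.L : ℝ)⁻¹) ^ (2 * (K - n))) + (3 : ℝ) ^ 2 * (C * ((ε * ((F.L : ℝ)⁻¹) ^ (2 * (K - n))) +
          R * (ε * ((F.L : ℝ)⁻¹) ^ (3 * (K - n))) + (R : ℝ) ^ 2 * (ε * ((F.L : ℝ)⁻¹) ^ (2 * (K - n))) ^ 2))) * Real.sqrt ((S : ℝ) / R) := by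
  obtain ⟨C, hC, h⟩ := dist1_axialT_translate_le (N := 2) (d := 3) (by norm_num)
  refine ⟨C, hC, fun F n K ε hε hε1 U hP hDiv y μ R S hR4 hRn hS1 hSR x s hx hxs hS => ?_⟩
  have hL : (0 : ℝ) ≤ ((F.L : ℝ)⁻¹) := inv_nonneg.2 (Nat.cast_nonneg _)
  have hL1 : ((F.L : ℝ)⁻¹) ≤ 1 := by
    have := F.hL.2
    exact inv_le_one_of_one_le₀ (by exact_mod_cast this.le)
  have ha0 : 0 ≤ ε * ((F.L : ℝ)⁻¹) ^ (2 * (K - n)) := mul_nonneg hε (pow_nonneg hL _)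
  have ha1 : ε * ((F.L : ℝ)⁻¹) ^ (2 * (K - n)) ≤ 1 := by
    calc ε * ((F.L : ℝ)⁻¹) ^ (2 * (K - n)) ≤ 1 * 1 := mul_le_mul hε1 (pow_le_one₀ hL hL1) (pow_nonneg hL _) zero_le_one
      _ = 1 := one_mul 1
  have hD : ∀ bd : PBond (F.P K) 0, ‖covDivT 1 (unitsField (toUField U)) bd.dir bd.src‖ ≤ ε * ((F.L : ℝ)⁻¹) ^ (3 * (K - n)) :=
    fun bd => (hDiv bd).le
  have hd3 : (((F.P K).d : ℕ) : ℝ) = 3 := by norm_num [show (F.P K).d = 3 from rfl]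
  have := h (F.P K) rfl 0 U _ _ ha0 ha1 hP hD y μ R S hR4 hRn hS1 hSR x s hx hxs hS
  rw [hd3] at this
  exact this

end T3

/-! ## §4′ (v1.1) The `hδ` companion: the torus axial-gauge representative is small on the no-wrap ball -/

section Smallness

variable {N : ℕ} [NeZero N] {P : Params} {j : ℕ}

open Summit.QuantumFields.YangMills.Theorems.AxialGaugeTorusTransfer (gaugeAct_axialT_transl gaugeAct_axialFn_map pull_unitsField_toUField)
open Literature.MathematicalPhysics.QuantumFieldTheory.Balaban1983to89.B7Prop1Explicit (l1 axial_bond_bound)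

/-- ★★ **THE `hδ` COMPANION — AXIAL SMALLNESS ON THE BALL FROM THE FIRST CLAUSE**: for `U : GaugeField P j SU(N)` with `PlaqSmall a U` (`0 ≤ a`), a centre
`y`, a no-wrap radius `R` (`2(R + 1) ≤ sitesPerDir j`) and `|x|_∞ ≤ R`: `dist1 ((U^{v₀})(y + x, μ)) ≤ |x|₁·a`, `v₀ = axialT U y` ([B7] p. 25 «|V₀(b) − 1| < |b₋ − y|α₀»
on the torus). [cite: Balaban1985Averaging, pp.24-25; Balaban1985UV3, (27)-(28) p.263] -/
theorem dist1_axialT_le (U : GaugeField P j (Matrix.specialUnitaryGroup (Fin N) ℂ)) {a : ℝ} (ha : 0 ≤ a) (hU : PlaqSmall a U) (y : Site P j)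
    {R : ℕ} (hR : 2 * (R + 1) ≤ P.sitesPerDir j) (x : B7Prop1Explicit.Site P.d) (hx : ∀ κ, |x κ| ≤ (R : ℤ)) (μ : Fin P.d) :
    dist1 (GaugeField.gaugeAct (axialT U y) U ⟨transl y x, μ⟩) ≤ (l1 x : ℝ) * a := by
  rw [gaugeAct_axialT_transl U y hR x hx μ]
  have h := axial_bond_bound (pull (unitsField (toUField U)) y) (pull_mem_U1 U y) 0
    (fun z κ μ' hne => norm_plaqF_pull_sub_one_le U hU y z κ μ' hne) ha x μ
  rw [sub_zero, pull_unitsField_toUField, gaugeAct_axialFn_map] at h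
  exact h

/-- … hence the uniform form `dist1 ((U^{v₀})(y + x, μ)) ≤ d·R·a` on the ball (`|x|₁ ≤ d·|x|_∞`). [cite: Balaban1985Averaging, pp.24-25] -/
theorem dist1_axialT_le_uniform (U : GaugeField P j (Matrix.specialUnitaryGroup (Fin N) ℂ)) {a : ℝ} (ha : 0 ≤ a) (hU : PlaqSmall a U)
    (y : Site P j) {R : ℕ} (hR : 2 * (R + 1) ≤ P.sitesPerDir j) (x : B7Prop1Explicit.Site P.d) (hx : ∀ κ, |x κ| ≤ (R : ℤ)) (μ : Fin P.d) :
    dist1 (GaugeField.gaugeAct (axialT U y) U ⟨transl y x, μ⟩) ≤ (P.d : ℝ) * R * a := by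
  refine (dist1_axialT_le U ha hU y hR x hx μ).trans (mul_le_mul_of_nonneg_right ?_ ha)
  have h1 : l1 x ≤ P.d * R := B10Eq27AxialLog.l1_le_mul_of_natAbs_le fun κ => by
    have := hx κ; rw [Int.abs_eq_natAbs] at this; exact_mod_cast this
  exact_mod_cast h1

/-! The operator-norm readings of the two rows — the currency of (G1-2)'s `hδ`∕`hΘ` — are already in the tree and are NOT restated:
`dist1 X = ‖X − 1‖` on `SU(N)` is ✓`BalabanUVNodes.N09Chi217AEContinuous.dist1_eq_norm_coe_sub_one` (and `rfl`), `dist1 (X′·X⁻¹) = ‖X′ − X‖` is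
✓`AxialGaugeTorusTransfer.dist1_mul_inv_eq_norm_sub`. -/

end Smallness

end Summit.QuantumFields.YangMills.Theorems.AxialGaugeMemberModulus

end
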